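import Summits.CriticalPhenomena.PercolationContinuityZ3.Theorems.PercNearOneGluingNoHeavyQuantGatedSliceMixLawRegimeBTwoMid
import HarnessLib

/-!
# QUANT lane R8, T-DEC, leg (III), blob case — regime B of `GatedSliceMixLaw'`, THE WEAK-MID ATOM BELOW A SATURATED TOP
# (`h < k₂ ≤ j`, cell `MixLawCellBTopBelow`): the two mixture certificates, with the scalar overflow inequality as a hypothesis

builds on p205010 (kernel theorem, internal audit signed; external expert review pending)

Support file (`--supports stmt-CriticalPhenomena-4575`), QUANT lane census seat (design 2, gen 61), rung R8 of
`run/shared/lean/prim/quant/LADDER.md`; memo `run/shared/lean/prim/quant/prim-quant-census-2-g61/REGIME-B-TOP-G61.md`.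
Theorems only, standard axioms, no sorries.

THE CELL.  The weak-mid law `W_h = (1−S/h)δ₀ + (S/h)(1−g)δ_h + (S/h)gδ_{h+a} ∉ D`, the moved law
`P = zδ₀ + m₁δ_{k₁} + m₁'δ_ℓ + m₂δ_{k₂} + m₂'δ_{k₂+a}` (`ℓ = k₁ + a` a `t`-low, `t = S + ag(1−z)`), BOTH `h` and `k₂` mids of the target
with `h < k₂` (so `k₂ − h ≤ a − 1`, as `h + a` is a giant), and the top `k₂` SATURATED by the shifted low: `m₂ ≤ U(ℓ,k₂)·m₁'`
(`U = usage y t j`).  The companion cell with `k₂ < h` is `…RegimeBTwoMid` / `…RegimeBTwoMidCheap`, where the overflow inequality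
FOLLOWS from the pooled inequality of `…Pooled` because `U(·,h) ≤ U(·,k₂)`; here `U(·,h) ≥ U(·,k₂)` and the inequality is a genuine
new scalar leaf, so it is taken as the hypothesis `hI` (the seat's exact census: 0 exceptions in 700 instances of the cell; the
assembly `mixLawCellBTopBelow_of_ineqs` is in `…RegimeBTopBelowCell`).

THE CERTIFICATES (`N = m₁' − m₂/U(ℓ,k₂) ≥ 0` the overflow of `ℓ`, `u = y/(1−y)`): `ℓ` fills `k₂` exactly and sends `N` into `W`'s
mid `h` at rate `U(ℓ,h)`; the zeros go to the giants `h + a`, `k₂ + a` at rate `u`; `k₁` goes to the giants (`…_kG`, hypothesis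
`U(ℓ,h)N + u·m₁ + u·z ≤ m₂'`) or — when cheap at `h` — into `h` (`…_kH`, hypothesis `U(ℓ,h)N + U(k₁,h)m₁ + u·z ≤ m₂'`); the kink
`θ·W_h(h) = (1−θ)·(demand on h)` balances `W`'s mid, and `W`'s own zero deficit `u(1−S/h) − (S/h)g ≤ (S/h)(1−g)` (from `y·h ≤ S`) is
paid by the same kink.  Flows by `flowAtT_pair` and `flowAtT_lows_giants₂` (`…RegimeBTwoMid`).

* `LawDec.gatedSliceMixLaw_regimeB_topBelow_kG`, `LawDec.gatedSliceMixLaw_regimeB_topBelow_kH`.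

[this work].  The gluing rows served [cite: KozmaNitzan2024, Conjecture 3 (p. 15)]; product measure [cite: Grimmett1999, §1.3 p. 10].
-/

noncomputable section

namespace Summit.CriticalPhenomena.PercolationContinuityZ3.Theorems

namespace Quant

open Finset

/-- the two-point law `{lo, hi; g}` (as in `…QuantLawDEC`) -/
local notation3 "TP[" lo ", " hi ", " g ", " h "]" =>
  (g : ℝ) * (if (h : ℕ) = (hi : ℕ) then (1 : ℝ) else 0) + (1 - (g : ℝ)) * (if (h : ℕ) = (lo : ℕ) then (1 : ℝ) else 0)

namespace LawDec

set_option maxHeartbeats 1600000 in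
/-- **`h < k₂`, TOP SATURATED, `k₁` TO THE GIANTS**: the mixture at the kink `θ·W_h(h) = (1−θ)·U(ℓ,h)·N`, given the overflow
inequality `hI : U(ℓ,h)·N + u·m₁ + u·z ≤ m₂'`. [this work] -/
theorem gatedSliceMixLaw_regimeB_topBelow_kG (y z g S lam : ℝ) (a j M h k₁ k₂ : ℕ)
    (hy0 : 0 < y) (hy1 : y < 1) (hz0 : 0 ≤ z) (hz1 : z < 1) (hg1 : g < 1) (hyg : y ≤ (1 - z) * g)
    (hS0 : 0 < S) (hta : y * (M : ℝ) ≤ S) (_hhj : h ≤ j) (hhM : h ≤ M) (hSh : S < (h : ℝ))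
    (hk : k₁ ≤ k₂) (hk₂M : k₂ ≤ M) (hlam0 : 0 ≤ lam) (hlam1 : lam ≤ 1)
    (hmean : (1 - z) * ((k₁ : ℝ) + ((k₂ : ℝ) - k₁) * lam) = S)
    (hk₁j : k₁ ≤ j) (hk1low : 2 * (k₁ : ℝ) < S + (a : ℝ) * g * (1 - z))
    (hllow : 2 * ((k₁ + a : ℕ) : ℝ) < S + (a : ℝ) * g * (1 - z)) (hlj : k₁ + a ≤ j) (hk₂aG : j + 1 ≤ k₂ + a) (hhaG : j + 1 ≤ h + a)
    (_hk₂j : k₂ ≤ j) (hk₂mid : S + (a : ℝ) * g * (1 - z) ≤ 2 * (k₂ : ℝ)) (hhk₂ : h < k₂)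
    (hhmid : S + (a : ℝ) * g * (1 - z) ≤ 2 * (h : ℝ))
    (hsat : (1 - z) * lam * (1 - g) ≤ usage y (S + (a : ℝ) * g * (1 - z)) j (k₁ + a) k₂ * ((1 - z) * (1 - lam) * g))
    (hI : usage y (S + (a : ℝ) * g * (1 - z)) j (k₁ + a) h
        * ((1 - z) * (1 - lam) * g - (1 - z) * lam * (1 - g) / usage y (S + (a : ℝ) * g * (1 - z)) j (k₁ + a) k₂)
      + y / (1 - y) * ((1 - z) * (1 - lam) * (1 - g)) + y / (1 - y) * z ≤ (1 - z) * lam * g) :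
    ∃ θ : ℝ, 0 ≤ θ ∧ θ < 1 ∧
      DECAtT y (S + (a : ℝ) * g * (1 - z)) j (M + a)
        (fun p => θ * weakMidLaw S g h a p
          + (1 - θ) * (z * (if p = 0 then (1 : ℝ) else 0) + (1 - z) * slice (fun q => TP[k₁, k₂, lam, q]) a g p)) := by
  classical
  set t : ℝ := S + (a : ℝ) * g * (1 - z) with ht
  have h1z : 0 < 1 - z := by linarith
  have hg0 : 0 < g := by nlinarith
  have h1y : 0 < 1 - y := by linarith
  have ha0 : (0 : ℝ) ≤ a := Nat.cast_nonneg a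
  have hk0 : (0 : ℝ) ≤ k₁ := Nat.cast_nonneg k₁
  have hh0 : (0 : ℝ) < h := lt_trans hS0 hSh
  have hhk₂' : (h : ℝ) < k₂ := by exact_mod_cast hhk₂
  have hyh : y * (h : ℝ) ≤ S := le_trans (mul_le_mul_of_nonneg_left (by exact_mod_cast hhM) hy0.le) hta
  have hyk₂ : y * (k₂ : ℝ) ≤ S := le_trans (mul_le_mul_of_nonneg_left (by exact_mod_cast hk₂M) hy0.le) hta
  have hlam0' : 0 ≤ 1 - lam := by linarith
  have hagw0 : 0 ≤ (a : ℝ) * g * (1 - z) := mul_nonneg (mul_nonneg ha0 hg0.le) h1z.le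
  have hagwa : (a : ℝ) * g * (1 - z) ≤ a := by nlinarith [mul_nonneg ha0 hg0.le]
  have ht0 : 0 < t := by rw [ht]; linarith
  -- masses
  set m₁ : ℝ := (1 - z) * (1 - lam) * (1 - g) with hm₁
  set m₁' : ℝ := (1 - z) * (1 - lam) * g with hm₁'
  set m₂ : ℝ := (1 - z) * lam * (1 - g) with hm₂
  set m₂' : ℝ := (1 - z) * lam * g with hm₂'
  have hm₁0 : 0 ≤ m₁ := mul_nonneg (mul_nonneg h1z.le hlam0') (by linarith)
  have hm₁'0 : 0 ≤ m₁' := mul_nonneg (mul_nonneg h1z.le hlam0') hg0.le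
  have hm₂0 : 0 ≤ m₂ := mul_nonneg (mul_nonneg h1z.le hlam0) (by linarith)
  have hm₂'0 : 0 ≤ m₂' := mul_nonneg (mul_nonneg h1z.le hlam0) hg0.le
  have hΛ : (1 - z) * lam = m₂ + m₂' := by rw [hm₂, hm₂']; ring
  -- λ < 1 (else m₁' = 0 < m₂ contradicts saturation), hence S < k₂
  have hlam1' : lam < 1 := by
    by_contra hc
    have hl1 : lam = 1 := le_antisymm hlam1 (not_lt.1 hc)
    have e1 : m₁' = 0 := by rw [hm₁', hl1]; ring
    have e2 : m₂ = (1 - z) * (1 - g) := by rw [hm₂, hl1]; ring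
    have h3 : m₂ ≤ 0 := by rw [e1, mul_zero] at hsat; exact hsat
    rw [e2] at h3
    nlinarith [mul_pos h1z (show (0:ℝ) < 1 - g by linarith)]
  have hSk₂ : S < (k₂ : ℝ) := by
    have hkk : (0 : ℝ) < (k₂ : ℝ) - k₁ := by linarith
    have hk₂pos : (0 : ℝ) ≤ k₂ := Nat.cast_nonneg k₂
    have e : (k₂ : ℝ) - S = z * k₂ + (1 - z) * (1 - lam) * ((k₂ : ℝ) - k₁) := by rw [← hmean]; ring
    have p1 : 0 < (1 - z) * (1 - lam) * ((k₂ : ℝ) - k₁) := mul_pos (mul_pos h1z (by linarith)) hkk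
    have p2 : 0 ≤ z * (k₂ : ℝ) := mul_nonneg hz0 hk₂pos
    linarith only [e, p1, p2]
  set w₀ : ℝ := 1 - S / h with hw₀
  set Wh : ℝ := S / h * (1 - g) with hWh
  set WG : ℝ := S / h * g with hWG
  have hSh' : 0 < S / (h : ℝ) := div_pos hS0 hh0
  have hw0 : 0 ≤ w₀ := by rw [hw₀, sub_nonneg, div_le_one hh0]; exact hSh.le
  have hWhpos : 0 < Wh := mul_pos hSh' (by linarith)
  have hWG0 : 0 ≤ WG := mul_nonneg hSh'.le hg0.le
  -- compatibilities
  have hcompk : t < ((k₁ + a : ℕ) : ℝ) + k₂ := by push_cast; rw [ht]; linarith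
  have hcomph : t < ((k₁ + a : ℕ) : ℝ) + h := by push_cast; rw [ht]; linarith
  have hlk : k₁ + a < k₂ := by
    have : ((k₁ + a : ℕ) : ℝ) < k₂ := by push_cast at hllow hcompk ⊢; linarith
    exact_mod_cast this
  have hlh : k₁ + a < h := by
    have : ((k₁ + a : ℕ) : ℝ) < h := by push_cast at hllow hcomph ⊢; linarith
    exact_mod_cast this
  -- rates
  set Ulk : ℝ := usage y t j (k₁ + a) k₂ with hUlk
  set Ulh : ℝ := usage y t j (k₁ + a) h with hUlh
  have hUlkpos : 0 < Ulk := usage_pos_of_compat y t j (k₁ + a) k₂ hy0 hy1 hllow hlk (Or.inr hcompk)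
  have hUlhpos : 0 < Ulh := usage_pos_of_compat y t j (k₁ + a) h hy0 hy1 hllow hlh (Or.inr hcomph)
  set α : ℝ := m₂ / Ulk with hα
  have hα0 : 0 ≤ α := div_nonneg hm₂0 hUlkpos.le
  have hαU : Ulk * α = m₂ := by rw [hα]; field_simp
  set N : ℝ := m₁' - α with hN
  have hN0 : 0 ≤ N := by rw [hN, hα, sub_nonneg, div_le_iff₀ hUlkpos]; linarith [hsat]
  set D : ℝ := Ulh * N with hD
  have hD0 : 0 ≤ D := mul_nonneg hUlhpos.le hN0
  obtain ⟨θ, hθ⟩ : ∃ q : ℝ, q = D / (D + Wh) := ⟨_, rfl⟩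
  have hden : 0 < D + Wh := by linarith
  have hθ0 : 0 ≤ θ := by rw [hθ]; exact div_nonneg hD0 hden.le
  have hθ1 : θ < 1 := by rw [hθ, div_lt_one hden]; linarith
  have h1θ : 0 < 1 - θ := by linarith
  have hkink : θ * Wh = (1 - θ) * D := by rw [hθ]; field_simp; ring
  -- the giant inequality
  have hu : y / (1 - y) * w₀ - WG ≤ Wh := by
    have h1 : y / (1 - y) * w₀ ≤ S / h := by
      rw [hw₀, show (1 : ℝ) - S / h = ((h : ℝ) - S) / h by field_simp, show y / (1 - y) * (((h : ℝ) - S) / h) = y * ((h : ℝ) - S) / ((1 - y) * h) by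
        field_simp, div_le_div_iff₀ (mul_pos h1y hh0) hh0]
      have hx := mul_nonneg hh0.le (sub_nonneg.2 hyh)
      linarith only [hx]
    have e : S / (h : ℝ) = WG + Wh := by rw [hWG, hWh]; ring
    linarith only [h1, e]
  have hDle : D + y / (1 - y) * m₁ + y / (1 - y) * z ≤ m₂' := hI
  have hG : y / (1 - y) * ((θ * w₀ + (1 - θ) * z) + (1 - θ) * m₁) ≤ θ * WG + (1 - θ) * m₂' := by
    have h1 : θ * (y / (1 - y) * w₀ - WG) ≤ θ * Wh := mul_le_mul_of_nonneg_left hu hθ0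
    have h2 : D ≤ m₂' - y / (1 - y) * z - y / (1 - y) * m₁ := by linarith
    have h3 : (1 - θ) * D ≤ (1 - θ) * (m₂' - y / (1 - y) * z - y / (1 - y) * m₁) := mul_le_mul_of_nonneg_left h2 h1θ.le
    linarith [h1, h3, hkink]
  -- pieces
  have Pk := flowAtT_pair y t j (M + a) (k₁ + a) k₂ ((1 - θ) * α) ((1 - θ) * m₂) hlj hllow (by omega) (Or.inr hk₂mid)
    (Or.inr hcompk) (mul_nonneg h1θ.le hα0) (le_of_eq (by rw [← hUlk, ← hαU]; ring))
  have Ph := flowAtT_pair y t j (M + a) (k₁ + a) h ((1 - θ) * N) (θ * Wh) hlj hllow (by omega) (Or.inr hhmid)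
    (Or.inr hcomph) (mul_nonneg h1θ.le hN0) (by rw [← hUlh]; nlinarith [hkink])
  have Pg := flowAtT_lows_giants₂ y t j (M + a) k₁ (h + a) (k₂ + a) (θ * w₀ + (1 - θ) * z) ((1 - θ) * m₁) (θ * WG) ((1 - θ) * m₂')
    hy0 hy1 (add_nonneg (mul_nonneg hθ0 hw0) (mul_nonneg h1θ.le hz0)) (mul_nonneg h1θ.le hm₁0) (mul_nonneg hθ0 hWG0)
    (mul_nonneg h1θ.le hm₂'0) hk₁j hk1low hhaG (by omega) hk₂aG (by omega) (by linarith [hG])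
  -- assemble
  have hsum := FlowAtT.add (FlowAtT.add Pk Ph) Pg
  have hflow : FlowAtT y t j (M + a) (fun p => θ * weakMidLaw S g h a p
      + (1 - θ) * (z * (if p = 0 then (1 : ℝ) else 0) + (1 - z) * slice (fun q => TP[k₁, k₂, lam, q]) a g p)) := by
    refine (congrArg (FlowAtT y t j (M + a)) (funext fun p => ?_)).mp hsum
    rw [movedTwoPoint_apply, ← hm₁, ← hm₁', ← hm₂, ← hm₂']
    unfold weakMidLaw
    rw [← hw₀, ← hWh, ← hWG]
    have eN : (1 - θ) * m₁' = (1 - θ) * α + (1 - θ) * N := by rw [hN]; ring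
    linear_combination (-(if p = k₁ + a then (1 : ℝ) else 0)) * eN
  exact gatedSliceMixLaw_conclusion_of_flowAtT y z g S lam θ a j M h k₁ k₂ hy0 hy1 hhM hk hk₂M hθ0 hθ1 hflow

set_option maxHeartbeats 1600000 in
/-- **`h < k₂`, TOP SATURATED, `k₁` CHEAP AT `h` AND SENT THERE**: the mixture at the kink `θ·W_h(h) = (1−θ)·(U(ℓ,h)·N + U(k₁,h)·m₁)`,
given `hI : U(ℓ,h)·N + U(k₁,h)·m₁ + u·z ≤ m₂'`. [this work] -/
theorem gatedSliceMixLaw_regimeB_topBelow_kH (y z g S lam : ℝ) (a j M h k₁ k₂ : ℕ)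
    (hy0 : 0 < y) (hy1 : y < 1) (hz0 : 0 ≤ z) (hz1 : z < 1) (hg1 : g < 1) (hyg : y ≤ (1 - z) * g)
    (hS0 : 0 < S) (hta : y * (M : ℝ) ≤ S) (hhj : h ≤ j) (hhM : h ≤ M) (hSh : S < (h : ℝ))
    (hk : k₁ ≤ k₂) (hk₂M : k₂ ≤ M) (hlam0 : 0 ≤ lam) (hlam1 : lam ≤ 1)
    (hmean : (1 - z) * ((k₁ : ℝ) + ((k₂ : ℝ) - k₁) * lam) = S)
    (hk₁j : k₁ ≤ j) (hk1low : 2 * (k₁ : ℝ) < S + (a : ℝ) * g * (1 - z))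
    (hllow : 2 * ((k₁ + a : ℕ) : ℝ) < S + (a : ℝ) * g * (1 - z)) (hlj : k₁ + a ≤ j) (hk₂aG : j + 1 ≤ k₂ + a) (hhaG : j + 1 ≤ h + a)
    (hk₂j : k₂ ≤ j) (hk₂mid : S + (a : ℝ) * g * (1 - z) ≤ 2 * (k₂ : ℝ)) (hhk₂ : h < k₂)
    (hhmid : S + (a : ℝ) * g * (1 - z) ≤ 2 * (h : ℝ))
    (hcheap : S + (a : ℝ) * g * (1 - z) - 2 * (k₁ : ℝ) ≤ y * ((h : ℝ) - k₁))
    (hsat : (1 - z) * lam * (1 - g) ≤ usage y (S + (a : ℝ) * g * (1 - z)) j (k₁ + a) k₂ * ((1 - z) * (1 - lam) * g))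
    (hI : usage y (S + (a : ℝ) * g * (1 - z)) j (k₁ + a) h
        * ((1 - z) * (1 - lam) * g - (1 - z) * lam * (1 - g) / usage y (S + (a : ℝ) * g * (1 - z)) j (k₁ + a) k₂)
      + usage y (S + (a : ℝ) * g * (1 - z)) j k₁ h * ((1 - z) * (1 - lam) * (1 - g)) + y / (1 - y) * z ≤ (1 - z) * lam * g) :
    ∃ θ : ℝ, 0 ≤ θ ∧ θ < 1 ∧
      DECAtT y (S + (a : ℝ) * g * (1 - z)) j (M + a)
        (fun p => θ * weakMidLaw S g h a p
          + (1 - θ) * (z * (if p = 0 then (1 : ℝ) else 0) + (1 - z) * slice (fun q => TP[k₁, k₂, lam, q]) a g p)) := by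
  classical
  set t : ℝ := S + (a : ℝ) * g * (1 - z) with ht
  have h1z : 0 < 1 - z := by linarith
  have hg0 : 0 < g := by nlinarith
  have h1y : 0 < 1 - y := by linarith
  have ha0 : (0 : ℝ) ≤ a := Nat.cast_nonneg a
  have hk0 : (0 : ℝ) ≤ k₁ := Nat.cast_nonneg k₁
  have hh0 : (0 : ℝ) < h := lt_trans hS0 hSh
  have hhk₂' : (h : ℝ) < k₂ := by exact_mod_cast hhk₂
  have hyh : y * (h : ℝ) ≤ S := le_trans (mul_le_mul_of_nonneg_left (by exact_mod_cast hhM) hy0.le) hta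
  have hyk₂ : y * (k₂ : ℝ) ≤ S := le_trans (mul_le_mul_of_nonneg_left (by exact_mod_cast hk₂M) hy0.le) hta
  have hlam0' : 0 ≤ 1 - lam := by linarith
  have hagw0 : 0 ≤ (a : ℝ) * g * (1 - z) := mul_nonneg (mul_nonneg ha0 hg0.le) h1z.le
  have hagwa : (a : ℝ) * g * (1 - z) ≤ a := by nlinarith [mul_nonneg ha0 hg0.le]
  have ht0 : 0 < t := by rw [ht]; linarith
  set m₁ : ℝ := (1 - z) * (1 - lam) * (1 - g) with hm₁
  set m₁' : ℝ := (1 - z) * (1 - lam) * g with hm₁'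
  set m₂ : ℝ := (1 - z) * lam * (1 - g) with hm₂
  set m₂' : ℝ := (1 - z) * lam * g with hm₂'
  have hm₁0 : 0 ≤ m₁ := mul_nonneg (mul_nonneg h1z.le hlam0') (by linarith)
  have hm₁'0 : 0 ≤ m₁' := mul_nonneg (mul_nonneg h1z.le hlam0') hg0.le
  have hm₂0 : 0 ≤ m₂ := mul_nonneg (mul_nonneg h1z.le hlam0) (by linarith)
  have hm₂'0 : 0 ≤ m₂' := mul_nonneg (mul_nonneg h1z.le hlam0) hg0.le
  have hΛ : (1 - z) * lam = m₂ + m₂' := by rw [hm₂, hm₂']; ring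
  have hlam1' : lam < 1 := by
    by_contra hc
    have hl1 : lam = 1 := le_antisymm hlam1 (not_lt.1 hc)
    have e1 : m₁' = 0 := by rw [hm₁', hl1]; ring
    have e2 : m₂ = (1 - z) * (1 - g) := by rw [hm₂, hl1]; ring
    have h3 : m₂ ≤ 0 := by rw [e1, mul_zero] at hsat; exact hsat
    rw [e2] at h3
    nlinarith [mul_pos h1z (show (0:ℝ) < 1 - g by linarith)]
  have hSk₂ : S < (k₂ : ℝ) := by
    have hkk : (0 : ℝ) < (k₂ : ℝ) - k₁ := by linarith
    have hk₂pos : (0 : ℝ) ≤ k₂ := Nat.cast_nonneg k₂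
    have e : (k₂ : ℝ) - S = z * k₂ + (1 - z) * (1 - lam) * ((k₂ : ℝ) - k₁) := by rw [← hmean]; ring
    have p1 : 0 < (1 - z) * (1 - lam) * ((k₂ : ℝ) - k₁) := mul_pos (mul_pos h1z (by linarith)) hkk
    have p2 : 0 ≤ z * (k₂ : ℝ) := mul_nonneg hz0 hk₂pos
    linarith only [e, p1, p2]
  set w₀ : ℝ := 1 - S / h with hw₀
  set Wh : ℝ := S / h * (1 - g) with hWh
  set WG : ℝ := S / h * g with hWG
  have hSh' : 0 < S / (h : ℝ) := div_pos hS0 hh0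
  have hw0 : 0 ≤ w₀ := by rw [hw₀, sub_nonneg, div_le_one hh0]; exact hSh.le
  have hWhpos : 0 < Wh := mul_pos hSh' (by linarith)
  have hWG0 : 0 ≤ WG := mul_nonneg hSh'.le hg0.le
  have hcompk : t < ((k₁ + a : ℕ) : ℝ) + k₂ := by push_cast; rw [ht]; linarith
  have hcomph : t < ((k₁ + a : ℕ) : ℝ) + h := by push_cast; rw [ht]; linarith
  have hcomp1h : t < (k₁ : ℝ) + h := by
    have hpos : (0 : ℝ) < (h : ℝ) - k₁ := by linarith
    have : y * ((h : ℝ) - k₁) < 1 * ((h : ℝ) - k₁) := mul_lt_mul_of_pos_right hy1 hpos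
    linarith only [this, hcheap]
  have hlk : k₁ + a < k₂ := by
    have : ((k₁ + a : ℕ) : ℝ) < k₂ := by push_cast at hllow hcompk ⊢; linarith
    exact_mod_cast this
  have hlh : k₁ + a < h := by
    have : ((k₁ + a : ℕ) : ℝ) < h := by push_cast at hllow hcomph ⊢; linarith
    exact_mod_cast this
  have hk1h : k₁ < h := by omega
  set Ulk : ℝ := usage y t j (k₁ + a) k₂ with hUlk
  set Ulh : ℝ := usage y t j (k₁ + a) h with hUlh
  set U1h : ℝ := usage y t j k₁ h with hU1h
  have hUlkpos : 0 < Ulk := usage_pos_of_compat y t j (k₁ + a) k₂ hy0 hy1 hllow hlk (Or.inr hcompk)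
  have hUlhpos : 0 < Ulh := usage_pos_of_compat y t j (k₁ + a) h hy0 hy1 hllow hlh (Or.inr hcomph)
  have hU1hpos : 0 < U1h := usage_pos_of_compat y t j k₁ h hy0 hy1 hk1low hk1h (Or.inr hcomp1h)
  have hU1u : U1h ≤ y / (1 - y) := by
    rw [hU1h]; exact usage_le_giant_of_light y t j k₁ h hy0 hy1 hhj hk1low hcomp1h hcheap
  -- overflow and kink
  set α : ℝ := m₂ / Ulk with hα
  have hα0 : 0 ≤ α := div_nonneg hm₂0 hUlkpos.le
  have hαU : Ulk * α = m₂ := by rw [hα]; field_simp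
  set N : ℝ := m₁' - α with hN
  have hN0 : 0 ≤ N := by rw [hN, hα, sub_nonneg, div_le_iff₀ hUlkpos]; linarith [hsat]
  set D : ℝ := Ulh * N + U1h * m₁ with hD
  have hD0 : 0 ≤ D := add_nonneg (mul_nonneg hUlhpos.le hN0) (mul_nonneg hU1hpos.le hm₁0)
  obtain ⟨θ, hθ⟩ : ∃ q : ℝ, q = D / (D + Wh) := ⟨_, rfl⟩
  have hden : 0 < D + Wh := by linarith
  have hθ0 : 0 ≤ θ := by rw [hθ]; exact div_nonneg hD0 hden.le
  have hθ1 : θ < 1 := by rw [hθ, div_lt_one hden]; linarith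
  have h1θ : 0 < 1 - θ := by linarith
  have hkink : θ * Wh = (1 - θ) * D := by rw [hθ]; field_simp; ring
  -- the giant inequality
  have hu : y / (1 - y) * w₀ - WG ≤ Wh := by
    have h1 : y / (1 - y) * w₀ ≤ S / h := by
      rw [hw₀, show (1 : ℝ) - S / h = ((h : ℝ) - S) / h by field_simp, show y / (1 - y) * (((h : ℝ) - S) / h) = y * ((h : ℝ) - S) / ((1 - y) * h) by
        field_simp, div_le_div_iff₀ (mul_pos h1y hh0) hh0]
      have hx := mul_nonneg hh0.le (sub_nonneg.2 hyh)
      linarith only [hx]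
    have e : S / (h : ℝ) = WG + Wh := by rw [hWG, hWh]; ring
    linarith only [h1, e]
  have hDle : D + y / (1 - y) * z ≤ m₂' := by rw [hD, hN, hα]; linarith only [hI]
  have hG : y / (1 - y) * ((θ * w₀ + (1 - θ) * z) + 0) ≤ θ * WG + (1 - θ) * m₂' := by
    have h1 : θ * (y / (1 - y) * w₀ - WG) ≤ θ * Wh := mul_le_mul_of_nonneg_left hu hθ0
    have h2 : D ≤ m₂' - y / (1 - y) * z := by linarith
    have h3 : (1 - θ) * D ≤ (1 - θ) * (m₂' - y / (1 - y) * z) := mul_le_mul_of_nonneg_left h2 h1θ.le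
    linarith [h1, h3, hkink]
  have Pk := flowAtT_pair y t j (M + a) (k₁ + a) k₂ ((1 - θ) * α) ((1 - θ) * m₂) hlj hllow (by omega) (Or.inr hk₂mid)
    (Or.inr hcompk) (mul_nonneg h1θ.le hα0) (le_of_eq (by rw [← hUlk, ← hαU]; ring))
  have Ph := flowAtT_pair y t j (M + a) (k₁ + a) h ((1 - θ) * N) (Ulh * ((1 - θ) * N)) hlj hllow (by omega) (Or.inr hhmid)
    (Or.inr hcomph) (mul_nonneg h1θ.le hN0) (by rw [← hUlh])
  have P1 := flowAtT_pair y t j (M + a) k₁ h ((1 - θ) * m₁) (θ * Wh - Ulh * ((1 - θ) * N)) hk₁j hk1low (by omega) (Or.inr hhmid)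
    (Or.inr hcomp1h) (mul_nonneg h1θ.le hm₁0) (by rw [← hU1h]; nlinarith [hkink])
  have Pg := flowAtT_lows_giants₂ y t j (M + a) k₁ (h + a) (k₂ + a) (θ * w₀ + (1 - θ) * z) 0 (θ * WG) ((1 - θ) * m₂')
    hy0 hy1 (add_nonneg (mul_nonneg hθ0 hw0) (mul_nonneg h1θ.le hz0)) le_rfl (mul_nonneg hθ0 hWG0)
    (mul_nonneg h1θ.le hm₂'0) hk₁j hk1low hhaG (by omega) hk₂aG (by omega) (by linarith [hG])
  -- assemble
  have hsum := FlowAtT.add (FlowAtT.add (FlowAtT.add Pk Ph) P1) Pg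
  have hflow : FlowAtT y t j (M + a) (fun p => θ * weakMidLaw S g h a p
      + (1 - θ) * (z * (if p = 0 then (1 : ℝ) else 0) + (1 - z) * slice (fun q => TP[k₁, k₂, lam, q]) a g p)) := by
    refine (congrArg (FlowAtT y t j (M + a)) (funext fun p => ?_)).mp hsum
    rw [movedTwoPoint_apply, ← hm₁, ← hm₁', ← hm₂, ← hm₂']
    unfold weakMidLaw
    rw [← hw₀, ← hWh, ← hWG]
    have eN : (1 - θ) * m₁' = (1 - θ) * α + (1 - θ) * N := by rw [hN]; ring
    linear_combination (-(if p = k₁ + a then (1 : ℝ) else 0)) * eN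
  exact gatedSliceMixLaw_conclusion_of_flowAtT y z g S lam θ a j M h k₁ k₂ hy0 hy1 hhM hk hk₂M hθ0 hθ1 hflow


end LawDec

end Quant

end Summit.CriticalPhenomena.PercolationContinuityZ3.Theorems
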